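import Summits.QuantumFields.YangMills.Theorems.MirrorModularBoostsHypercubicLimitClosureHalvesDefs
import Summits.QuantumFields.YangMills.Theorems.LangevinControlUVOSLegsFromFemtoAndGapDefsR3
import HarnessLib

/-!
# Stub `stub_ntOfSkewSeparated` (P1) for line `Sketch` of crux `WeakCouplingHypercubicLimit`

A CONTINUUM lemma: for a one-field Schwinger family `S₁` on `ℝ⁴` with the connected Cauchy–Schwarz property
`ConnCS S₁`, a non-zero third cumulant `κ₃(f, g, h)` in time-separated position (`f` at negative times, `g, h`
at positive times, `g ⊗ h` off-diagonal) forces a non-zero time-ordered truncated two-point function.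

Proof.  Suppose every time-ordered truncated two-point function vanishes.  Put `F' := Θ Ff*` (the OS adjoint
of the one-point tensor `Ff` of `f`); it is time-ordered (arity one, positive time), so `conn(F', F') = 0`, and
Cauchy–Schwarz `‖conn(F', G)‖² ≤ conn(F', F') · conn(G, G)` with `G := Fgh` kills `conn(F', Fgh)`, i.e.
`S₃(f ⊗ g ⊗ h) = S₁(f) S₂(g ⊗ h)`; likewise `S₂(f ⊗ h) = S₁(f) S₁(h)` and `S₂(f ⊗ g) = S₁(f) S₁(g)` from the
hypothesis with `(F', Fh)`, `(F', Fg)`.  Substituting, `κ₃ = 0`, a contradiction.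
-/

noncomputable section

open scoped SchwartzMap
open MeasureTheory Filter Topology
open Literature.MathematicalPhysics.AQFT Literature.MathematicalPhysics.QuantumLattice
open Literature.MathematicalPhysics.QuantumFieldTheory
open Summit.QuantumFields.YangMills.Cruxes.HypercubicLimit.CouplingResponse
open Summit.QuantumFields.YangMills.Cruxes.OSLegsFromFemtoAndGap.DlrCollarTransfer (conn Decay RPPos ConnCS)

namespace Summit.QuantumFields.YangMills.Theorems.WeakCouplingHypercubicLimit.TraceNormColdPressure

/-- A one-point tensor `F = φ` (arity one) of a positive-time `φ` is time-ordered: its support lies over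
`tsupport φ ⊆ {x⁰ > 0}` and the ordering condition on a single time is vacuous. [folklore] -/
theorem isTimeOrdered_one_of_isTensorOf {φ : 𝓢(EuclideanSpace ℝ (Fin 4), ℂ)}
    {F : 𝓢((Fin 1 → EuclideanSpace ℝ (Fin 4)), ℂ)} (hF : IsTensorOf F ![φ])
    (hφ : tsupport (φ : EuclideanSpace ℝ (Fin 4) → ℂ) ⊆ {y : EuclideanSpace ℝ (Fin 4) | 0 < y 0}) :
    IsTimeOrdered F := by
  rw [SchwingerFamily.isTimeOrdered_iff_isPositiveTimeMulti_one]
  intro x hx i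
  have hi := hF.tsupport_subset hx i
  fin_cases i
  exact hφ hi

/-- The OS adjoint `Θ F*` of a one-point tensor `F = φ` of a NEGATIVE-time `φ` is time-ordered (`Θ` exchanges
`𝒮₋` and `𝒮₊`; arity one). [folklore] -/
theorem isTimeOrdered_osAdjoint_one_of_isTensorOf {φ : 𝓢(EuclideanSpace ℝ (Fin 4), ℂ)}
    {F : 𝓢((Fin 1 → EuclideanSpace ℝ (Fin 4)), ℂ)} (hF : IsTensorOf F ![φ])
    (hφ : tsupport (φ : EuclideanSpace ℝ (Fin 4) → ℂ) ⊆ {y : EuclideanSpace ℝ (Fin 4) | y 0 < 0}) :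
    IsTimeOrdered (osAdjoint F) := by
  rw [SchwingerFamily.isTimeOrdered_iff_isPositiveTimeMulti_one]
  refine isPositiveTimeMulti_osAdjoint fun x hx i => ?_
  have hi := hF.tsupport_subset hx i
  fin_cases i
  exact hφ hi

/-- A two-point tensor `g ⊗ h` of positive-time `g, h` is positive-time. [folklore] -/
theorem isPositiveTimeMulti_two_of_isTensorOf {g h : 𝓢(EuclideanSpace ℝ (Fin 4), ℂ)}
    {F : 𝓢((Fin 2 → EuclideanSpace ℝ (Fin 4)), ℂ)} (hF : IsTensorOf F ![g, h])
    (hg : tsupport (g : EuclideanSpace ℝ (Fin 4) → ℂ) ⊆ {y : EuclideanSpace ℝ (Fin 4) | 0 < y 0})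
    (hh : tsupport (h : EuclideanSpace ℝ (Fin 4) → ℂ) ⊆ {y : EuclideanSpace ℝ (Fin 4) | 0 < y 0}) :
    IsPositiveTimeMulti F := by
  intro x hx i
  have hi := hF.tsupport_subset hx i
  fin_cases i
  · exact hg hi
  · exact hh hi

/-- Every one-point test function is off-diagonal: the coincidence locus of arity one is empty. [folklore] -/
theorem isOffDiagonal_one (F : 𝓢((Fin 1 → EuclideanSpace ℝ (Fin 4)), ℂ)) : IsOffDiagonal F := by
  rintro x ⟨i, j, hij, -⟩
  exact absurd (Subsingleton.elim i j) hij

/-- `f ⊗ (g ⊗ h) = f ⊗ g ⊗ h`: appending the one-point tensor of `f` to a two-point tensor of `g, h` gives a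
three-point tensor of `f, g, h`. [folklore] -/
theorem isTensorOf_appendTensor_one_two {f g h : 𝓢(EuclideanSpace ℝ (Fin 4), ℂ)}
    {Ff : 𝓢((Fin 1 → EuclideanSpace ℝ (Fin 4)), ℂ)} {Fgh : 𝓢((Fin 2 → EuclideanSpace ℝ (Fin 4)), ℂ)}
    (hTf : IsTensorOf Ff ![f]) (hTgh : IsTensorOf Fgh ![g, h]) :
    IsTensorOf (n := 3) (Ff.appendTensor Fgh) ![f, g, h] := by
  intro x
  rw [SchwartzMap.appendTensor_apply, hTf, hTgh]
  simp only [Fin.prod_univ_one, Fin.prod_univ_two, Fin.prod_univ_three, Function.comp_apply,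
    Matrix.cons_val_zero, Matrix.cons_val_one, Matrix.cons_val_two, Matrix.head_cons, Matrix.tail_cons]
  rw [mul_assoc]
  rfl

/-- `f ⊗ g` from the one-point tensors of `f` and `g` (arity `1 + 1 = 2`). [folklore] -/
theorem isTensorOf_appendTensor_one_one {f g : 𝓢(EuclideanSpace ℝ (Fin 4), ℂ)}
    {Ff Fg : 𝓢((Fin 1 → EuclideanSpace ℝ (Fin 4)), ℂ)}
    (hTf : IsTensorOf Ff ![f]) (hTg : IsTensorOf Fg ![g]) :
    IsTensorOf (n := 2) (Ff.appendTensor Fg) ![f, g] := by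
  intro x
  rw [SchwartzMap.appendTensor_apply, hTf, hTg]
  simp only [Fin.prod_univ_one, Fin.prod_univ_two, Function.comp_apply,
    Matrix.cons_val_zero, Matrix.cons_val_one]
  rfl

/-- **P1 (`stub_ntOfSkewSeparated`).**  For a one-field family with `ConnCS`, a non-zero third cumulant in
time-separated position (`f` at negative, `g, h` at positive times) forces a non-zero time-ordered truncated
two-point function: otherwise `conn(ΘFf*, ΘFf*) = 0`, Cauchy–Schwarz kills `conn(ΘFf*, Fgh)`, i.e.
`S₃ = S₁ S₂`, and with `S₂(f ⊗ h) = S₁ S₁`, `S₂(f ⊗ g) = S₁ S₁` the cumulant combination vanishes. -/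
theorem stub_ntOfSkewSeparated : ∀ (S₁ : SchwingerFamily (EuclideanSpace ℝ (Fin 4))), ConnCS S₁ → (∃ (f g h : 𝓢(EuclideanSpace ℝ (Fin 4), ℂ)) (Ffgh : 𝓢((Fin 3 → EuclideanSpace ℝ (Fin 4)), ℂ)) (Fgh Ffh Ffg : 𝓢((Fin 2 → EuclideanSpace ℝ (Fin 4)), ℂ)) (Ff Fg Fh : 𝓢((Fin 1 → EuclideanSpace ℝ (Fin 4)), ℂ)), tsupport (f : EuclideanSpace ℝ (Fin 4) → ℂ) ⊆ {y : EuclideanSpace ℝ (Fin 4) | y 0 < 0} ∧ tsupport (g : EuclideanSpace ℝ (Fin 4) → ℂ) ⊆ {y : EuclideanSpace ℝ (Fin 4) | 0 < y 0} ∧ tsupport (h : EuclideanSpace ℝ (Fin 4) → ℂ) ⊆ {y : EuclideanSpace ℝ (Fin 4) | 0 < y 0} ∧ IsOffDiagonal Fgh ∧ IsTensorOf Ffgh ![f, g, h] ∧ IsOffDiagonal Ffgh ∧ IsTensorOf Fgh ![g, h] ∧ IsTensorOf Ffh ![f, h] ∧ IsTensorOf Ffg ![f, g] ∧ IsTensorOf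 Ff ![f] ∧ IsTensorOf Fg ![g] ∧ IsTensorOf Fh ![h] ∧ S₁.toLabelled 3 (fun _ => ()) Ffgh - S₁.toLabelled 1 (fun _ => ()) Ff * S₁.toLabelled 2 (fun _ => ()) Fgh - S₁.toLabelled 1 (fun _ => ()) Fg * S₁.toLabelled 2 (fun _ => ()) Ffh - S₁.toLabelled 1 (fun _ => ()) Fh * S₁.toLabelled 2 (fun _ => ()) Ffg + 2 * (S₁.toLabelled 1 (fun _ => ()) Ff * S₁.toLabelled 1 (fun _ => ()) Fg * S₁.toLabelled 1 (fun _ => ()) Fh) ≠ 0) → ∃ (F₁ G₁ : 𝓢((Fin 1 → EuclideanSpace ℝ (Fin 4)), ℂ)) (H₁ : 𝓢((Fin (1 + 1) → EuclideanSpace ℝ (Fin 4)), ℂ)), IsTimeOrdered F₁ ∧ IsTimeOrdered G₁ ∧ IsAppendTensorOf H₁ (osAdjoint F₁) G₁ ∧ S₁.toLabelled (1 + 1) (fun _ => ()) H₁ ≠ S₁.toLabelled 1 (fun _ => ()) (osAdjoint F₁) * S₁.toLabelled 1 (fun _ => ()) G₁ := by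
  rintro S₁ hCS ⟨f, g, h, Ffgh, Fgh, Ffh, Ffg, Ff, Fg, Fh, hf, hg, hh, hodgh, hT3, -, hTgh, hTfh, hTfg, hTf,
    hTg, hTh, hκ⟩
  by_contra hNT
  push Not at hNT
  simp only [SchwingerFamily.toLabelled_apply] at hNT hκ
  -- every time-ordered pair has vanishing connected OS form
  have hNT' : ∀ F₁ G₁ : 𝓢((Fin 1 → EuclideanSpace ℝ (Fin 4)), ℂ), IsTimeOrdered F₁ → IsTimeOrdered G₁ →
      conn S₁ F₁ G₁ = 0 := fun F₁ G₁ h₁ h₂ =>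
    sub_eq_zero.2 (hNT F₁ G₁ _ h₁ h₂ (isAppendTensorOf_appendTensor _ _))
  -- the players: `F' = Θ Ff*` (time-ordered), `Fg`, `Fh` (time-ordered), `Fgh` (positive-time, off-diagonal)
  set F' : 𝓢((Fin 1 → EuclideanSpace ℝ (Fin 4)), ℂ) := osAdjoint Ff with hF'def
  have hF'to : IsTimeOrdered F' := isTimeOrdered_osAdjoint_one_of_isTensorOf hTf hf
  have hFgto : IsTimeOrdered Fg := isTimeOrdered_one_of_isTensorOf hTg hg
  have hFhto : IsTimeOrdered Fh := isTimeOrdered_one_of_isTensorOf hTh hh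
  have hGpos : IsPositiveTimeMulti Fgh := isPositiveTimeMulti_two_of_isTensorOf hTgh hg hh
  have hadj : osAdjoint F' = Ff := by rw [hF'def, osAdjoint_osAdjoint]
  -- (b) `conn(F', F') = 0`, (c) Cauchy–Schwarz kills `conn(F', Fgh)`
  have hFF : conn S₁ F' F' = 0 := hNT' F' F' hF'to hF'to
  obtain ⟨-, -, hcs⟩ := hCS 1 2 F' Fgh hF'to.isPositiveTimeMulti (isOffDiagonal_one F') hGpos hodgh
  have hFG : conn S₁ F' Fgh = 0 := by
    have h2 : ‖conn S₁ F' Fgh‖ ^ 2 ≤ 0 := by simpa [hFF] using hcs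
    have h0 : ‖conn S₁ F' Fgh‖ = 0 :=
      pow_eq_zero_iff two_ne_zero |>.1 (le_antisymm h2 (sq_nonneg _))
    exact norm_eq_zero.1 h0
  -- (d) identify the tensors
  have e3 : (Ff.appendTensor Fgh : 𝓢((Fin 3 → EuclideanSpace ℝ (Fin 4)), ℂ)) = Ffgh :=
    (isTensorOf_appendTensor_one_two hTf hTgh).unique hT3
  have efh : (Ff.appendTensor Fh : 𝓢((Fin 2 → EuclideanSpace ℝ (Fin 4)), ℂ)) = Ffh :=
    (isTensorOf_appendTensor_one_one hTf hTh).unique hTfh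
  have efg : (Ff.appendTensor Fg : 𝓢((Fin 2 → EuclideanSpace ℝ (Fin 4)), ℂ)) = Ffg :=
    (isTensorOf_appendTensor_one_one hTf hTg).unique hTfg
  have key3 : S₁ 3 Ffgh = S₁ 1 Ff * S₁ 2 Fgh := by
    have h0 := hFG
    simp only [conn, hadj] at h0
    rw [← e3]
    exact sub_eq_zero.1 h0
  have keyfh : S₁ 2 Ffh = S₁ 1 Ff * S₁ 1 Fh := by
    have h0 := hNT' F' Fh hF'to hFhto
    simp only [conn, hadj] at h0
    rw [← efh]
    exact sub_eq_zero.1 h0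
  have keyfg : S₁ 2 Ffg = S₁ 1 Ff * S₁ 1 Fg := by
    have h0 := hNT' F' Fg hF'to hFgto
    simp only [conn, hadj] at h0
    rw [← efg]
    exact sub_eq_zero.1 h0
  -- (e) the cumulant combination vanishes
  apply hκ
  rw [key3, keyfh, keyfg]
  ring

end Summit.QuantumFields.YangMills.Theorems.WeakCouplingHypercubicLimit.TraceNormColdPressure

end
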